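import Mathlib
import Summits.Ventures.PercRepro.TriangleCapOneBelow

/-!
# PercRepro — THE ROWS ONE, TWO AND THREE BELOW THE THRESHOLD OF THE `K₄⁻`-FREE CHERRY TABLE, EXACT FOR EVERY `t ≥ 5`
(p3, gen 32; part 16 — the cells `j ≤ 3` below the threshold of TriangleCapRowGeneral, all at once)

TriangleCapOneBelow closes the cell one below the threshold `2k + t ≥ t² + 6` for every `t ≥ 4`.  This module
closes the cells `j = 1, 2, 3` below it for every `t ≥ 5` in one statement: **`cherries_le_star_value_add_of_k4mFree`**
— for `t ≥ 5`, `j ≤ 3` and `t² + 6 ≤ 2k + t + 2j` every `K₄⁻`-free graph with `k − 1 + t` edges on `k` vertices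
has `Σ_v C(d(v), 2) ≤ C(k − 1, 2) + 2t + j` — and **`rows_below_exact`**: at `2k + t + 2j = t² + 6` the maximum is
exactly `C(k − 1, 2) + 2t + j = C(k − 2, 2) + C(t + 1, 2) + t + 1`, the value of `K_{2,t+1}` plus `k − t − 3` pendant
edges at one big vertex (`bipPend k t`), which stays the extremal value `j` steps below the threshold as long as
the count has slack `4j` — it does for `j ≤ 3` once `t ≥ 5` (`(10, 14) = 49`, `(11, 15) = 57`, `(12, 16) = 66` at
`t = 5`; `(15, 20) = 106`, `(16, 21) = 119`, `(17, 22) = 133` at `t = 6`).  At `t = 4` only `j = 1` closes this way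
(TriangleCapOneBelow; the cell `(7, 10)` two below needs a finer count of the defect sum).

THE PROOF is TriangleCapOneBelow's, verbatim in structure, with the slack `4j` carried through: at a vertex of
MAXIMUM degree `d = t + a` the key inequality `2T + 2t(t − 3) + 4g ≤ Y + 4ag + 4j` holds in every case — `g = 0`
(no threshold); `a ≥ 2, g ≥ 1` (`4(a − 1)g ≥ 4(a + g) − 8` and the `j`-below threshold `(t − 1)(t − 2) + 2 ≤ 2(a + g) + 2j`,
with `Y ≥ 2T`); `a = 1` and `a = 0` (the defect-sum bounds `Y ≥ 4(m′ − δ)(δ − 2)` and `Y ≥ 2m′(m′ − 5)`, which for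
`t ≥ 5` have room `4j` without the parity of `T`).  Degrees `≤ t − 1` give `cherries ≤ (t − 2)m`.  Axioms: standard.
-/

namespace PercRepro

namespace TriangleCap

namespace C047

open Finset

variable {V : Type*} [Fintype V] [DecidableEq V]

/-- `j` below the threshold, `(s + 5)² + 6 ≤ 2k + (s + 5) + 2j` with `k = s + 6 + a + g`, reads
`(s + 4)(s + 3) + 2 ≤ 2(a + g) + 2j`. -/
theorem below_threshold_arith (s a g j : ℕ)
    (hk : (s + 5) * (s + 5) + 6 ≤ 2 * (s + 6 + a + g) + (s + 5) + 2 * j) :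
    (s + 4) * (s + 3) + 2 ≤ 2 * (a + g) + 2 * j := by
  ring_nf at hk ⊢
  omega

/-- The degree-cap arithmetic `j ≤ 3` below the threshold (`K = k − 1`, all degrees `≤ t − 1 = s + 4`):
`(s + 3)(K + s + 5) ≤ C(K, 2) + 2(s + 5) + j`. -/
theorem below_degree_cap_arith (K s j : ℕ) (hj : j ≤ 3)
    (hk : (s + 5) * (s + 5) + 6 ≤ 2 * (K + 1) + (s + 5) + 2 * j) :
    (s + 3) * (K + (s + 5)) ≤ K.choose 2 + 2 * (s + 5) + j := by
  have hC := two_mul_choose_two_add K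
  have hsq : (s + 5) * (s + 5) = s * s + 10 * s + 25 := by ring
  rw [hsq] at hk
  obtain ⟨y, hy⟩ : ∃ y, 2 * K = s * s + 9 * s + 18 + y := ⟨2 * K - (s * s + 9 * s + 18), by omega⟩
  have hQ : 8 * K.choose 2 + 2 * (2 * K) = (2 * K) * (2 * K) := by nlinarith [hC]
  have h8 : 8 * ((s + 3) * (K + (s + 5))) = 4 * (s + 3) * (2 * K) + 8 * (s + 3) * (s + 5) := by ring
  rw [hy] at hQ h8
  nlinarith [hQ, h8, hj, Nat.zero_le (y * y), Nat.zero_le (s * y), Nat.zero_le (s * s * y),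
    Nat.zero_le (s * s), Nat.zero_le (s * s * s), Nat.zero_le (s * s * s * s)]

/-- The case `a = 0` (maximum degree `t`), a vertex of off-degree `δ ≥ 4`, `j ≤ 3` below. -/
theorem below_a0_delta_arith (g δ s Y T j : ℕ) (hj : j ≤ 3) (h4 : 4 ≤ δ) (hδ : δ ≤ s + 5 + 0)
    (hg : (s + 4) * (s + 3) + 2 ≤ 2 * (0 + g) + 2 * j) (hT : T ≤ s + 5 + 0)
    (hY : 4 * ((g + (s + 5) - δ) * (δ - 2)) ≤ Y) :
    2 * T + 2 * (s + 5) * (s + 2) + 4 * g ≤ Y + 4 * (0 * g) + 4 * j := by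
  obtain ⟨x, rfl⟩ : ∃ x, δ = 4 + x := ⟨δ - 4, by omega⟩
  obtain ⟨r, hr⟩ : ∃ r, s + 1 = x + r := ⟨s + 1 - x, by omega⟩
  have hg3 : 4 ≤ g := by nlinarith [hg, Nat.zero_le (s * s), Nat.zero_le s]
  have e1 : g + (s + 5) - (4 + x) = g + r := by omega
  have e2 : 4 + x - 2 = 2 + x := by omega
  rw [e1, e2] at hY
  have hgx : x * ((s + 4) * (s + 3) + 2) ≤ x * (2 * (0 + g) + 2 * j) := Nat.mul_le_mul_left x hg
  nlinarith [hY, hg, hgx, hT, hj, Nat.zero_le (x * r), Nat.zero_le (x * x), Nat.zero_le (x * x * r),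
    Nat.zero_le (x * r * r), Nat.zero_le (x * x * x), Nat.zero_le (x * g), Nat.zero_le (r * g),
    Nat.zero_le (x * j), Nat.zero_le (s * s), Nat.zero_le (x * s)]

/-- The case `a = 0`, every off-degree `≤ 3`, `j ≤ 3` below. -/
theorem below_a0_small_arith (g s Y T j : ℕ) (hj : j ≤ 3)
    (h : 2 * (g + (s + 5)) * (g + (s + 5) + 1 - 2 * 3) ≤ Y)
    (hg : (s + 4) * (s + 3) + 2 ≤ 2 * (0 + g) + 2 * j) (hT : T ≤ s + 5 + 0) :
    2 * T + 2 * (s + 5) * (s + 2) + 4 * g ≤ Y + 4 * (0 * g) + 4 * j := by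
  have hg4 : 4 ≤ g := by nlinarith [hg, Nat.zero_le (s * s), Nat.zero_le s]
  obtain ⟨p, rfl⟩ : ∃ p, g = p + 4 := ⟨g - 4, by omega⟩
  have e : p + 4 + (s + 5) + 1 - 2 * 3 = p + s + 4 := by omega
  rw [e] at h
  nlinarith [h, hT, Nat.zero_le (p * p), Nat.zero_le (p * s), Nat.zero_le (s * s)]

/-- The case `a = 1` (maximum degree `t + 1`), a vertex of off-degree `δ ≥ 4`, `j ≤ 3` below. -/
theorem below_a1_delta_arith (g δ s Y T j : ℕ) (hj : j ≤ 3) (h4 : 4 ≤ δ) (hδ : δ ≤ s + 5 + 1)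
    (hg : (s + 4) * (s + 3) + 2 ≤ 2 * (1 + g) + 2 * j) (hT : T ≤ s + 5 + 1)
    (hY : 4 * ((g + (s + 5) - δ) * (δ - 2)) ≤ Y) :
    2 * T + 2 * (s + 5) * (s + 2) + 4 * g ≤ Y + 4 * (1 * g) + 4 * j := by
  obtain ⟨x, rfl⟩ : ∃ x, δ = 4 + x := ⟨δ - 4, by omega⟩
  obtain ⟨r, hr⟩ : ∃ r, s + 2 = x + r := ⟨s + 2 - x, by omega⟩
  have hg3 : 3 ≤ g := by nlinarith [hg, Nat.zero_le (s * s), Nat.zero_le s]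
  have e1 : g + (s + 5) - (4 + x) = g + r - 1 := by omega
  have e2 : 4 + x - 2 = 2 + x := by omega
  rw [e1, e2] at hY
  obtain ⟨g', rfl⟩ : ∃ g', g = g' + 3 := ⟨g - 3, by omega⟩
  have e3 : g' + 3 + r - 1 = g' + r + 2 := by omega
  rw [e3] at hY
  have hgx : x * ((s + 4) * (s + 3) + 2) ≤ x * (2 * (1 + (g' + 3)) + 2 * j) := Nat.mul_le_mul_left x hg
  nlinarith [hY, hg, hgx, hT, hj, Nat.zero_le (x * r), Nat.zero_le (x * x), Nat.zero_le (x * x * r),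
    Nat.zero_le (x * r * r), Nat.zero_le (x * x * x), Nat.zero_le (x * g'), Nat.zero_le (r * g'),
    Nat.zero_le (x * j), Nat.zero_le (s * s), Nat.zero_le (x * s)]

/-- The case `a = 1`, every off-degree `≤ 3`, `j ≤ 3` below. -/
theorem below_a1_small_arith (g s Y T j : ℕ) (hj : j ≤ 3)
    (h : 2 * (g + (s + 5)) * (g + (s + 5) + 1 - 2 * 3) ≤ Y)
    (hg : (s + 4) * (s + 3) + 2 ≤ 2 * (1 + g) + 2 * j) (hT : T ≤ s + 5 + 1) :
    2 * T + 2 * (s + 5) * (s + 2) + 4 * g ≤ Y + 4 * (1 * g) + 4 * j := by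
  have hg3 : 3 ≤ g := by nlinarith [hg, Nat.zero_le (s * s), Nat.zero_le s]
  obtain ⟨p, rfl⟩ : ∃ p, g = p + 3 := ⟨g - 3, by omega⟩
  have e : p + 3 + (s + 5) + 1 - 2 * 3 = p + s + 3 := by omega
  rw [e] at h
  nlinarith [h, hT, Nat.zero_le (p * p), Nat.zero_le (p * s), Nat.zero_le (s * s)]

/-- The case `a ≥ 2, g ≥ 1`: `Y ≥ 2T` and the `j`-below threshold give the key inequality with slack `4j`. -/
theorem below_ag_arith (s a g Y T j : ℕ) (hY : 2 * T ≤ Y) (ha : 2 ≤ a) (hg : 1 ≤ g)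
    (hag0 : (s + 4) * (s + 3) + 2 ≤ 2 * (a + g) + 2 * j) :
    2 * T + 2 * (s + 5) * (s + 2) + 4 * g ≤ Y + 4 * (a * g) + 4 * j := by
  obtain ⟨a', rfl⟩ : ∃ a', a = a' + 2 := ⟨a - 2, by omega⟩
  obtain ⟨g', rfl⟩ : ∃ g', g = g' + 1 := ⟨g - 1, by omega⟩
  ring_nf at hag0 ⊢
  nlinarith [hY, hag0, Nat.zero_le (a' * g')]

/-- The dominating case `g = 0`, `j` below: the exact count has slack `4j` to spare. -/
theorem below_g0_arith (s a Y T j : ℕ) (hT2 : T = 2 * (0 + (s + 5)))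
    (hTT : T * T ≤ 2 * Y + 2 * T) :
    2 * T + 2 * (s + 5) * (s + 2) + 4 * 0 ≤ Y + 4 * (a * 0) + 4 * j := by
  subst hT2
  ring_nf at hTT ⊢
  omega

/-- The final arithmetic `j` below the threshold: with `t = s + 5`, `d = s + 5 + a`, `k − 1 = s + 5 + a + g`,
`m = 2s + 10 + a + g`, `|R| = 2(g + s + 5)`, the combined bound and `2T + 2t(t − 3) + 4g ≤ Y + 4ag + 4j`
give `cherries ≤ C(k − 1, 2) + 2(s + 5) + j`. -/
theorem below_final_arith (s2 Y T a g s ch C j : ℕ)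
    (hfin : 2 * s2 + (2 * (g + (s + 5))) * (s + 5 + a) + Y ≤
      2 * ((s + 5 + a) * (s + 5 + a)) + 2 * (s + 5 + a) + 2 * (2 * (g + (s + 5))) + 2 * T +
        (2 * (g + (s + 5))) * (2 * s + 10 + a + g) + 2 * (g + (s + 5)))
    (hc : 2 * ch + 2 * (2 * s + 10 + a + g) = s2)
    (hC : 2 * C + (s + 5 + a + g) = (s + 5 + a + g) * (s + 5 + a + g))
    (hkey : 2 * T + 2 * (s + 5) * (s + 2) + 4 * g ≤ Y + 4 * (a * g) + 4 * j) :
    ch ≤ C + 2 * (s + 5) + j := by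
  nlinarith [hfin, hc, hC, hkey]

/-- `bipPend` arithmetic: `C(K, 2) + C(t + 1, 2) + t + 1 = C(K + 1, 2) + 2t + j` at `2(K + 2) + t + 2j = t² + 6`. -/
theorem bipPend_value_arith (K t j : ℕ) (hk : 2 * (K + 2) + t + 2 * j = t * t + 6) :
    K.choose 2 + (t + 1).choose 2 + (t + 1) = (K + 1).choose 2 + 2 * t + j := by
  have h1 := two_mul_choose_two_add K
  have h2 := two_mul_choose_two_add (K + 1)
  have h3 := two_mul_choose_two_add (t + 1)
  nlinarith [h1, h2, h3, hk]

/-- **THE ROWS `j ≤ 3` BELOW THE THRESHOLD, THE BOUND (`t ≥ 5`):** for `t ≥ 5`, `j ≤ 3` and `t² + 6 ≤ 2k + t + 2j` every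
`K₄⁻`-free graph with `k − 1 + t` edges on `k` vertices has `Σ_v C(d(v), 2) ≤ C(k − 1, 2) + 2t + j`. -/
theorem cherries_le_star_value_add_of_k4mFree (t j : ℕ) (ht : 5 ≤ t) (hj : j ≤ 3) (D : SimpleGraph V)
    [DecidableRel D.Adj] (hK : K4mFree D) (hk : t * t + 6 ≤ 2 * Fintype.card V + t + 2 * j)
    (hm : D.edgeFinset.card + 1 = Fintype.card V + t) :
    cherries D ≤ (Fintype.card V - 1).choose 2 + 2 * t + j := by
  obtain ⟨s, rfl⟩ : ∃ s, t = s + 5 := ⟨t - 5, by omega⟩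
  clear ht
  by_cases hdeg : ∀ v, deg D v ≤ s + 4
  · -- every degree `≤ t − 1`: `2·cherries ≤ (t − 2) Σ d = (t − 2)·2m`
    have h2 : 2 * cherries D ≤ (s + 4 - 1) * ∑ v, deg D v := by
      unfold cherries
      rw [mul_sum, mul_sum]
      exact sum_le_sum (fun v _ => two_mul_choose_two_le_pred_mul _ _ (hdeg v))
    rw [sum_deg_eq] at h2
    have h3 : s + 4 - 1 = s + 3 := by omega
    rw [h3] at h2
    have hsq : 5 * (s + 5) ≤ (s + 5) * (s + 5) := Nat.mul_le_mul_right _ (by omega)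
    obtain ⟨K, hK1⟩ : ∃ K, Fintype.card V = K + 1 := ⟨Fintype.card V - 1, by omega⟩
    rw [hK1] at hk hm ⊢
    rw [Nat.add_sub_cancel]
    have h4 := below_degree_cap_arith K s j hj hk
    have h5 : D.edgeFinset.card = K + (s + 5) := by omega
    rw [h5] at h2
    have h6 : (s + 3) * (2 * (K + (s + 5))) = 2 * ((s + 3) * (K + (s + 5))) := by ring
    rw [h6] at h2
    omega
  · push Not at hdeg
    obtain ⟨u, hu⟩ := hdeg
    -- a vertex of maximum degree, of degree `≥ t`
    obtain ⟨v, -, hmax⟩ := exists_max_image univ (deg D) ⟨u, mem_univ u⟩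
    have hmax' : ∀ w, deg D w ≤ deg D v := fun w => hmax w (mem_univ w)
    have hv : s + 5 ≤ deg D v := by
      have := hmax' u
      omega
    -- the split of `2 Σ d²` (TriangleCapDiagonal) and the counts at `v`
    have hS := sum_adjPairsAll_deg_add D
    have hsplit1 := sum_filter_add_sum_filter_not (adjPairsAll D) (fun p => p.1 = v)
      (fun p => deg D p.1 + deg D p.2)
    have hsplit2 := sum_filter_add_sum_filter_not ((adjPairsAll D).filter (fun p => ¬ p.1 = v))
      (fun p => p.2 = v) (fun p => deg D p.1 + deg D p.2)
    rw [filter_not_fst_filter_snd, filter_not_fst_filter_not_snd] at hsplit2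
    have hfst := sum_filter_fst_deg_add D v
    have hsnd := sum_filter_snd_deg_add D v
    have hA := sum_deg_neighbors_eq D v
    have hE := two_mul_card_E_le D v
    have hT := card_T_le_deg D hK v
    have hTR : ((offPairs D v).filter (fun p => D.Adj v p.1 ∧ D.Adj v p.2)).card ≤
      (offPairs D v).card := card_filter_le _ _
    have hRc := two_mul_card_edges_eq D v
    have hR1 := sum_R_add_sum_avoid_le D v
    have hc := two_mul_cherries_add D
    rw [sum_deg_eq] at hc
    have hdk : deg D v + 1 ≤ Fintype.card V := by
      have hsub : univ.filter (fun w => D.Adj v w) ⊆ univ.erase v := by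
        intro w hw
        rw [mem_filter] at hw
        rw [mem_erase]
        exact ⟨(D.ne_of_adj hw.2).symm, mem_univ _⟩
      have h1 : deg D v ≤ (univ.erase v).card := card_le_card hsub
      rw [card_erase_of_mem (mem_univ v), card_univ] at h1
      have h2 : 1 ≤ Fintype.card V := Fintype.card_pos_iff.mpr ⟨v⟩
      omega
    -- the combined linear bound with the defect sum
    have hmain : 2 * (∑ x, deg D x * deg D x) + (offPairs D v).card * deg D v +
        ∑ p ∈ offPairs D v, (avoid D v p).card ≤
        2 * (deg D v * deg D v) + 2 * deg D v +
          4 * ((offPairs D v).filter (fun p => D.Adj v p.1)).card +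
          (offPairs D v).card * D.edgeFinset.card + (offPairs D v).card := by
      linarith [hS, hsplit1, hsplit2, hfst, hsnd, hA, hR1]
    -- the structural facts, instantiated
    have hTT := card_T_mul_card_T_le D hK v
    have hthree : 3 ≤ ((offPairs D v).filter (fun p => D.Adj v p.1 ∧ D.Adj v p.2)).card →
        (offPairs D v).card ≤ ∑ p ∈ offPairs D v, (avoid D v p).card :=
      fun h => card_offPairs_le_sum_avoid_of_three_le D hK v h
    have heven := card_T_eq_two_mul D v
    have hdom : deg D v + 1 = Fintype.card V →
        ((offPairs D v).filter (fun p => D.Adj v p.1 ∧ D.Adj v p.2)).card = (offPairs D v).card :=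
      fun h => congrArg card (filter_T_eq_offPairs_of_deg_add_one_eq_card D h)
    have hfour : 4 ≤ (offEdges D v).card →
        0 < ((offPairs D v).filter (fun p => D.Adj v p.1 ∧ D.Adj v p.2)).card →
        Fintype.card V < D.edgeFinset.card → 4 ≤ ∑ p ∈ offPairs D v, (avoid D v p).card :=
      fun h1 h2 h3 => four_le_sum_avoid_of_card_lt D hK v h1 h2 h3
    have hEc := card_offEdges D v
    -- a vertex `c` of maximum off-degree, for the cases of maximum degree `t` and `t + 1`
    obtain ⟨c, -, hcmax⟩ := exists_max_image univ (outDeg D v) ⟨v, mem_univ v⟩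
    have hcmax' : ∀ w, outDeg D v w ≤ outDeg D v c := fun w => hcmax w (mem_univ w)
    have hδd : outDeg D v c ≤ deg D v := (outDeg_le_deg D v c).trans (hmax' c)
    have hδ1 := sum_avoid_ge_of_outDeg D v c
    have hδ2 : outDeg D v c ≤ 3 →
        (offPairs D v).card * ((offEdges D v).card + 1 - 2 * 3) ≤ ∑ p ∈ offPairs D v, (avoid D v p).card :=
      fun h => sum_avoid_ge_of_outDeg_le D v 3 (fun w => (hcmax' w).trans h)
    -- names for the quantities
    set T := ((offPairs D v).filter (fun p => D.Adj v p.1 ∧ D.Adj v p.2)).card with hTdef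
    set M := (((offPairs D v).filter (fun p => D.Adj v p.1 ∧ D.Adj v p.2)).image
      (fun q => s(q.1, q.2))).card with hMdef
    set E := ((offPairs D v).filter (fun p => D.Adj v p.1)).card with hEdef
    set Rc := (offPairs D v).card with hRcdef
    set Y := ∑ p ∈ offPairs D v, (avoid D v p).card with hYdef
    set Ec := (offEdges D v).card with hEcdef
    set δ := outDeg D v c with hδdef
    set d := deg D v with hddef
    set m := D.edgeFinset.card with hmdef
    set k := Fintype.card V with hkdef
    set ch := cherries D with hchdef
    set s2 := ∑ x, deg D x * deg D x with hs2def
    clear_value T M E Rc Y Ec δ d m k ch s2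
    have hfin : 2 * s2 + Rc * d + Y ≤ 2 * (d * d) + 2 * d + 2 * Rc + 2 * T + Rc * m + Rc := by
      linarith [hmain, hE]
    clear hmain hS hsplit1 hsplit2 hfst hsnd hA hR1 hE hTdef hMdef hEdef hRcdef hYdef hEcdef hδdef hddef
      hmdef hkdef hchdef hs2def hmax hmax' hcmax hcmax' hu
    obtain ⟨a, rfl⟩ : ∃ a, d = s + 5 + a := ⟨d - (s + 5), by omega⟩
    obtain ⟨g, rfl⟩ : ∃ g, k = s + 6 + a + g := ⟨k - (s + 6 + a), by omega⟩
    have hm' : m = 2 * s + 10 + a + g := by omega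
    subst hm'
    have hRc' : Rc = 2 * (g + (s + 5)) := by omega
    subst hRc'
    have hEc' : Ec = g + (s + 5) := by omega
    subst hEc'
    have e1 : s + 6 + a + g - 1 = s + 5 + a + g := by omega
    rw [e1]
    have hC := two_mul_choose_two_add (s + 5 + a + g)
    -- the `j`-below threshold: `2(a + g) + 2j ≥ (s + 4)(s + 3) + 2`
    have hag0 := below_threshold_arith s a g j hk
    -- THE KEY INEQUALITY: `2T + 2t(t − 3) + 4g ≤ Y + 4ag + 4j` in every case
    have hkey : 2 * T + 2 * (s + 5) * (s + 2) + 4 * g ≤ Y + 4 * (a * g) + 4 * j := by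
      rcases Nat.eq_zero_or_pos g with hg | hg
      · -- the dominating vertex: `T = |R| = 2t`, `Y ≥ T(T − 2)/2`
        subst hg
        have hT2 := hdom (by omega)
        exact below_g0_arith s a Y T j hT2 hTT
      · rcases (by omega : a = 0 ∨ a = 1 ∨ 2 ≤ a) with ha | ha | ha
        · -- maximum degree `t`: the defect sum seen from `c`
          subst ha
          by_cases hδ4 : 4 ≤ δ
          · have h4Y := four_mul_le_of_halves (g + (s + 5)) δ Y hδ1 (by omega)
            exact below_a0_delta_arith g δ s Y T j hj hδ4 hδd hag0 hT h4Y
          · have h := hδ2 (by omega)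
            exact below_a0_small_arith g s Y T j hj h hag0 hT
        · -- maximum degree `t + 1`: the defect sum seen from `c`
          subst ha
          by_cases hδ4 : 4 ≤ δ
          · have h4Y := four_mul_le_of_halves (g + (s + 5)) δ Y hδ1 (by omega)
            exact below_a1_delta_arith g δ s Y T j hj hδ4 hδd hag0 hT h4Y
          · have h := hδ2 (by omega)
            exact below_a1_small_arith g s Y T j hj h hag0 hT
        · -- `a ≥ 2, g ≥ 1`: `4(a − 1)g ≥ 2t(t − 3) − 4j` and `Y ≥ 2T`
          have hY : 2 * T ≤ Y := by
            by_cases h6 : 6 ≤ T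
            · have := Nat.mul_le_mul_right T h6
              omega
            · by_cases h3 : 3 ≤ T
              · have := hthree h3
                omega
              · rcases Nat.eq_zero_or_pos T with hT0 | hT0
                · omega
                · have h2 : T = 2 := by omega
                  have := hfour (by omega) hT0 (by omega)
                  omega
          exact below_ag_arith s a g Y T j hY ha hg hag0
    exact below_final_arith s2 Y T a g s ch _ j hfin hc hC hkey

/-- The cherries of `bipPend k t` exceed the star value by exactly `j` when `2k + t + 2j = t² + 6`
(`t ≥ 5`, `j ≤ 3`, so that `k ≥ t + 3`). -/
theorem cherries_bipPend_eq_star_add (k t j : ℕ) (ht : 5 ≤ t) (hj : j ≤ 3)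
    (hk : 2 * k + t + 2 * j = t * t + 6) :
    cherries (bipPend k t) = (k - 1).choose 2 + 2 * t + j := by
  have hk3 : t + 3 ≤ k := by nlinarith [hk, hj, ht]
  rw [cherries_bipPend k t hk3]
  obtain ⟨K, rfl⟩ : ∃ K, k = K + 2 := ⟨k - 2, by omega⟩
  rw [Nat.add_sub_cancel, show K + 2 - 1 = K + 1 from by omega]
  exact bipPend_value_arith K t j hk

/-- `j` below the threshold (`t ≥ 5`, `j ≤ 3`) the graph `bipPend k t` is `K₄⁻`-free with `k − 1 + t` edges and
`C(k − 1, 2) + 2t + j` cherries. -/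
theorem exists_k4mFree_cherries_eq_star_add (k t j : ℕ) (ht : 5 ≤ t) (hj : j ≤ 3)
    (hk : 2 * k + t + 2 * j = t * t + 6) :
    ∃ (D : SimpleGraph (Fin k)) (_ : DecidableRel D.Adj),
      K4mFree D ∧ D.edgeFinset.card + 1 = k + t ∧ cherries D = (k - 1).choose 2 + 2 * t + j :=
  ⟨bipPend k t, inferInstance, k4mFree_bipPend k t, card_edges_bipPend k t (by nlinarith [hk, hj, ht]),
    cherries_bipPend_eq_star_add k t j ht hj hk⟩

/-- **THE ROWS `j = 1, 2, 3` BELOW THE THRESHOLD, EXACT (`t ≥ 5`):** for `t ≥ 5`, `j ≤ 3` and `2k + t + 2j = t² + 6`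
the `K₄⁻`-free cherry maximum at `(k, k − 1 + t)` is exactly `C(k − 1, 2) + 2t + j = C(k − 2, 2) + C(t + 1, 2) + t + 1`,
attained by `K_{2,t+1}` plus `k − t − 3` pendant edges at one big vertex (`j = 0` is the star value of `rows_exact`,
where the two families tie). -/
theorem rows_below_exact (t k j : ℕ) (ht : 5 ≤ t) (hj : j ≤ 3) (hk : 2 * k + t + 2 * j = t * t + 6) :
    (∀ (D : SimpleGraph (Fin k)) [DecidableRel D.Adj], K4mFree D → D.edgeFinset.card + 1 = k + t →
        cherries D ≤ (k - 1).choose 2 + 2 * t + j) ∧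
      ∃ (D : SimpleGraph (Fin k)) (_ : DecidableRel D.Adj),
        K4mFree D ∧ D.edgeFinset.card + 1 = k + t ∧ cherries D = (k - 1).choose 2 + 2 * t + j := by
  refine ⟨fun D _ hK hD => ?_, exists_k4mFree_cherries_eq_star_add k t j ht hj hk⟩
  have hk' : t * t + 6 ≤ 2 * Fintype.card (Fin k) + t + 2 * j := by
    rw [Fintype.card_fin]
    omega
  have := cherries_le_star_value_add_of_k4mFree t j ht hj D hK hk' (by rw [hD]; simp)
  simpa using this

/-- The cells below the threshold at `t = 5` and `t = 6`: `(10, 14) = 49`, `(11, 15) = 57`, `(12, 16) = 66`;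
`(15, 20) = 106`, `(16, 21) = 119`, `(17, 22) = 133`. -/
theorem rows_below_values :
    ((9 : ℕ).choose 2 + 2 * 5 + 3 = 49 ∧ 2 * 10 + 5 + 2 * 3 = 5 * 5 + 6) ∧
      ((10 : ℕ).choose 2 + 2 * 5 + 2 = 57 ∧ 2 * 11 + 5 + 2 * 2 = 5 * 5 + 6) ∧
      ((11 : ℕ).choose 2 + 2 * 5 + 1 = 66 ∧ 2 * 12 + 5 + 2 * 1 = 5 * 5 + 6) ∧
      ((14 : ℕ).choose 2 + 2 * 6 + 3 = 106 ∧ 2 * 15 + 6 + 2 * 3 = 6 * 6 + 6) ∧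
      ((15 : ℕ).choose 2 + 2 * 6 + 2 = 119 ∧ 2 * 16 + 6 + 2 * 2 = 6 * 6 + 6) ∧
      ((16 : ℕ).choose 2 + 2 * 6 + 1 = 133 ∧ 2 * 17 + 6 + 2 * 1 = 6 * 6 + 6) := by
  decide

/-- The cell `(11, 15) = 57` (`t = 5`, two below the threshold `k = 13`), exact in the kernel. -/
theorem eleven_fifteen_exact :
    (∀ (D : SimpleGraph (Fin 11)) [DecidableRel D.Adj], K4mFree D → D.edgeFinset.card = 15 →
        cherries D ≤ 57) ∧
      ∃ (D : SimpleGraph (Fin 11)) (_ : DecidableRel D.Adj),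
        K4mFree D ∧ D.edgeFinset.card = 15 ∧ cherries D = 57 := by
  obtain ⟨h1, D, inst, hK, hm, hc⟩ := rows_below_exact 5 11 2 (by norm_num) (by norm_num) (by norm_num)
  have e : (11 - 1).choose 2 + 2 * 5 + 2 = 57 := by decide
  refine ⟨fun D _ hK hD => ?_, D, inst, hK, by omega, by omega⟩
  have := h1 D hK (by omega)
  omega

end C047

end TriangleCap

end PercRepro
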